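/- Free-seat work of WIDTH SEAT `ym-line-cbag-p1-w2` (prover-ym-line-cbag-p1-w2-g17-0), route `EguchiKawaiDirectionLadder`
(ideator ym-idea-2, LINE 8), crux `TripleSmallBallMargin` (stmt-QuantumFields-27724): COROLLARIES of the margin door
(`…MarginOfFibreBound`): width seat w5's `ConditionalTripleBound` implies the crux DIRECTLY, and so does the weaker
floored-rigidity fibre bound for every `γ ∈ (0,1]`; for `γ ≤ 1/2` the latter follows from the former.  Implications only;
neither fibre bound is proved here.  The route bears on the barrier-ledger fact `EguchiKawaiBreakdown`; the Yang–Mills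
mass gap is NOT proved by anything in this file. -/
import Summits.QuantumFields.YangMills.Theorems.EguchiKawaiDirectionLadderMarginOfFibreBound
import HarnessLib

/-!
# Route `EguchiKawaiDirectionLadder`, crux `TripleSmallBallMargin`: corollaries of the margin door

* `productFibreBound_mono` — a product-form fibre bound with a smaller non-negative pair factor implies the one with a
  larger factor.
* `triplePairFactor_envelope` — `triplePairFactor` (w5, `…ConditionalTripleDefs`) obeys the envelopes `(1/2, 1)`:
  `x·pf ≤ t^{3/2}`, `x²·pf ≤ t²`; hence `tripleSmallBallMargin_of_conditionalTripleBound :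
  ConditionalTripleBound → TripleSmallBallMargin` (limiting exponent `7/8`, the one-loop value at two antipodal clusters).
* `flooredRigidityFactor_envelope` — `(t/max(x, t^{1−γ}))²` obeys `(γ, 1)`; hence
  `tripleSmallBallMargin_of_flooredRigidity : ProductFibreBound (flooredRigidityFactor γ) → TripleSmallBallMargin` for every
  `γ ∈ (0,1]`: the crux needs only a `t^{2γ}` surcharge per pair of `U 0`-eigenvalues closer than `t^{(1−γ)/2}` on top of
  two-link entrywise rigidity.  (The MEANINGFUL range is `0 < γ ≤ 1/2`: at `θ = 0` the floored bound is the pair small ball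
  with exponent `γ·N²`, which fails beyond `1/2` — the implication is then vacuous.)
* `triplePairFactor_le_flooredRigidityFactor`, `productFibreBound_flooredRigidity_of_conditionalTripleBound` — for
  `0 ≤ γ ≤ 1/2` the floored-rigidity fibre bound is WEAKER than `ConditionalTripleBound`.
-/

set_option autoImplicit false

noncomputable section

open MeasureTheory
open scoped ENNReal Real
open Literature.Barriers.QuantumFields

namespace Summit.QuantumFields.YangMills.Theorems.EguchiKawaiDirectionLadder

/-! ### Monotonicity in the pair factor -/

/-- Monotonicity: a product-form fibre bound with a smaller (non-negative) pair factor implies the one with a larger factor. -/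
theorem productFibreBound_mono {g g' : ℝ → ℝ → ℝ}
    (hg : ∀ t x : ℝ, 0 < t → t ≤ 1 → 0 ≤ x → 0 ≤ g t x)
    (hle : ∀ t x : ℝ, 0 < t → t ≤ 1 → 0 ≤ x → g t x ≤ g' t x) (h : ProductFibreBound g) :
    ProductFibreBound g' := by
  intro η hη
  obtain ⟨C, hC, N₀, hb⟩ := h η hη
  refine ⟨C, hC, N₀, fun N hN t ht ht1 θ => le_trans (hb N hN t ht ht1 θ) (ENNReal.ofReal_le_ofReal ?_)⟩
  refine mul_le_mul_of_nonneg_left ?_ (Real.exp_pos _).le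
  refine Finset.prod_le_prod (fun j _ => Finset.prod_nonneg fun k _ => hg _ _ ht ht1 (by positivity)) fun j _ => ?_
  exact Finset.prod_le_prod (fun k _ => hg _ _ ht ht1 (by positivity)) fun k _ => hle _ _ ht ht1 (by positivity)


/-! ### Corollary 1 — `ConditionalTripleBound` closes the crux directly -/

/-- `triplePairFactor` obeys the envelopes `(γ, K) = (1/2, 1)`: with `m = max(x,t)`, `x·pf ≤ (t²/m)·min(1, m²/t) ≤ t^{3/2}`
(cases `m ≤ √t`, `m ≥ √t`) and `x²·pf ≤ t²·min(1, m²/t) ≤ t²`. -/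
theorem triplePairFactor_envelope : PairFactorEnvelope triplePairFactor (1 / 2) 1 := by
  intro t x ht ht1 hx0 hx4
  set m : ℝ := max x t with hm
  have hmx : x ≤ m := le_max_left _ _
  have hmt : t ≤ m := le_max_right _ _
  have hm0 : 0 < m := lt_of_lt_of_le ht hmt
  have hmin0 : 0 ≤ min 1 (m ^ 2 / t) := le_min zero_le_one (by positivity)
  have hmin1 : min 1 (m ^ 2 / t) ≤ 1 := min_le_left _ _
  have hpf : triplePairFactor t x = (t / m) ^ 2 * min 1 (m ^ 2 / t) := rfl
  have hsq : Real.sqrt t * Real.sqrt t = t := Real.mul_self_sqrt ht.le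
  have hsqpos : 0 < Real.sqrt t := Real.sqrt_pos.mpr ht
  refine ⟨by rw [hpf]; positivity, ?_, ?_⟩
  · have h32 : t ^ (1 + 1 / 2 : ℝ) = t * Real.sqrt t := by
      rw [Real.rpow_add ht, Real.rpow_one, Real.sqrt_eq_rpow]
    rw [h32, hpf]
    by_cases hms : m ≤ Real.sqrt t
    · calc x * ((t / m) ^ 2 * min 1 (m ^ 2 / t)) ≤ m * ((t / m) ^ 2 * (m ^ 2 / t)) := by
            gcongr
            exact min_le_right _ _
        _ = t * m := by field_simp
        _ ≤ t * Real.sqrt t := by gcongr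
    · push Not at hms
      calc x * ((t / m) ^ 2 * min 1 (m ^ 2 / t)) ≤ m * ((t / m) ^ 2 * 1) := by gcongr
        _ = t * (t / m) := by field_simp
        _ ≤ t * Real.sqrt t := by
            gcongr
            rw [div_le_iff₀ hm0]
            nlinarith
  · calc x ^ 2 * triplePairFactor t x = x ^ 2 * ((t / m) ^ 2 * min 1 (m ^ 2 / t)) := by rw [hpf]
      _ ≤ m ^ 2 * ((t / m) ^ 2 * 1) := by gcongr
      _ = 1 * t ^ 2 := by field_simp

/-- **`ConditionalTripleBound ⇒ TripleSmallBallMargin`** — width seat w5's conditional triple bound (the fibrewise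
Bhanot–Heller–Neuberger per-pair accounting against a fixed diagonal first link) implies the route's crux
stmt-QuantumFields-27724 BY NAME, directly (no profile-resolved / rank-robust within-cluster level in between). -/
theorem tripleSmallBallMargin_of_conditionalTripleBound (h : ConditionalTripleBound) :
    Summit.QuantumFields.YangMills.Theses.EguchiKawaiDirectionLadder.TripleSmallBallMargin :=
  tripleSmallBallMargin_of_productFibreBound (γ := 1 / 2) (K := 1) (by norm_num) (by norm_num) one_pos
    triplePairFactor_envelope (conditionalTripleBound_iff_productFibreBound.mp h)

/-! ### Corollary 2 — the floored-rigidity fibre bound closes the crux for every `γ ∈ (0,1]` -/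

/-- The floored-rigidity factor obeys the envelopes `(γ, 1)`: with `m = max(x, t^{1−γ})`,
`x·(t/m)² ≤ t²/m ≤ t²/t^{1−γ} = t^{1+γ}` and `x²·(t/m)² ≤ t²`. -/
theorem flooredRigidityFactor_envelope (γ : ℝ) : PairFactorEnvelope (flooredRigidityFactor γ) γ 1 := by
  intro t x ht ht1 hx0 hx4
  set m : ℝ := max x (t ^ (1 - γ)) with hm
  have htg : 0 < t ^ (1 - γ) := Real.rpow_pos_of_pos ht _
  have hmx : x ≤ m := le_max_left _ _
  have hmt : t ^ (1 - γ) ≤ m := le_max_right _ _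
  have hm0 : 0 < m := lt_of_lt_of_le htg hmt
  have hfl : flooredRigidityFactor γ t x = (t / m) ^ 2 := rfl
  refine ⟨by rw [hfl]; positivity, ?_, ?_⟩
  · have hsplit : t ^ (1 + γ) = t ^ 2 / t ^ (1 - γ) := by
      rw [show (1 + γ : ℝ) = 2 - (1 - γ) by ring, Real.rpow_sub ht, Real.rpow_two]
    rw [hfl, hsplit]
    calc x * (t / m) ^ 2 ≤ m * (t / m) ^ 2 := by gcongr
      _ = t ^ 2 / m := by field_simp
      _ ≤ t ^ 2 / t ^ (1 - γ) := by gcongr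
  · rw [hfl]
    calc x ^ 2 * (t / m) ^ 2 ≤ m ^ 2 * (t / m) ^ 2 := by gcongr
      _ = 1 * t ^ 2 := by field_simp

/-- **Floored rigidity ⇒ crux**: for every `γ ∈ (0,1]`, the product-form fibre bound with the floored-rigidity factor
`(t/max(x, t^{1−γ}))²` — two-link entrywise rigidity plus a `t^{2γ}` surcharge per pair of `U 0`-eigenvalues closer than
`t^{(1−γ)/2}` — implies `TripleSmallBallMargin`.  (Rigidity alone, `γ = 0`, gives only the exponent `3/4 − δ/4 − ε/2`; the
hypothesis is plausible only for `γ ≤ 1/2`, where at `θ = 0` it is the pair small ball with exponent `γ·N²`.) -/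
theorem tripleSmallBallMargin_of_flooredRigidity {γ : ℝ} (hγ : 0 < γ) (hγ1 : γ ≤ 1)
    (h : ProductFibreBound (flooredRigidityFactor γ)) :
    Summit.QuantumFields.YangMills.Theses.EguchiKawaiDirectionLadder.TripleSmallBallMargin :=
  tripleSmallBallMargin_of_productFibreBound hγ hγ1 one_pos (flooredRigidityFactor_envelope γ) h

/-- For `0 ≤ γ ≤ 1/2` the floored-rigidity factor DOMINATES `triplePairFactor` (on `0 < t ≤ 1`, any `x`): above the floor
both are `(t/x)²` up to the pair cost `≤ 1`; below it `pf ≤ t ≤ t^{2γ}`. -/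
theorem triplePairFactor_le_flooredRigidityFactor {γ t x : ℝ} (hγ0 : 0 ≤ γ) (hγ : γ ≤ 1 / 2)
    (ht : 0 < t) (ht1 : t ≤ 1) :
    triplePairFactor t x ≤ flooredRigidityFactor γ t x := by
  have htg : 0 < t ^ (1 - γ) := Real.rpow_pos_of_pos ht _
  have htg1 : t ≤ t ^ (1 - γ) := by
    have := Real.rpow_le_rpow_of_exponent_ge ht ht1 (show (1 - γ : ℝ) ≤ 1 by linarith)
    rwa [Real.rpow_one] at this
  have hmin0 : 0 ≤ min 1 (max x t ^ 2 / t) := le_min zero_le_one (by positivity)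
  have hmin1 : min 1 (max x t ^ 2 / t) ≤ 1 := min_le_left _ _
  unfold triplePairFactor flooredRigidityFactor
  by_cases hxf : t ^ (1 - γ) ≤ x
  · -- above the floor: both maxima are `x`
    have hxt : t ≤ x := le_trans htg1 hxf
    rw [max_eq_left hxt, max_eq_left hxf]
    calc (t / x) ^ 2 * min 1 (x ^ 2 / t) ≤ (t / x) ^ 2 * 1 := by gcongr; exact min_le_left _ _
      _ = (t / x) ^ 2 := mul_one _
  · -- below the floor: `pf ≤ t ≤ t^{2γ} = (t / t^{1-γ})²`
    push Not at hxf
    rw [max_eq_right hxf.le]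
    have hm0 : 0 < max x t := lt_of_lt_of_le ht (le_max_right _ _)
    have h1 : (t / max x t) ^ 2 * min 1 (max x t ^ 2 / t) ≤ t := by
      calc (t / max x t) ^ 2 * min 1 (max x t ^ 2 / t) ≤ (t / max x t) ^ 2 * (max x t ^ 2 / t) := by
            gcongr; exact min_le_right _ _
        _ = t := by field_simp
    have h2 : t ≤ (t / t ^ (1 - γ)) ^ 2 := by
      have hq : t / t ^ (1 - γ) = t ^ γ := by
        rw [div_eq_iff htg.ne', ← Real.rpow_add ht, show γ + (1 - γ) = (1 : ℝ) by ring, Real.rpow_one]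
      rw [hq, ← Real.rpow_natCast, ← Real.rpow_mul ht.le]
      have : t ^ (1 : ℝ) ≤ t ^ (γ * (2 : ℕ)) :=
        Real.rpow_le_rpow_of_exponent_ge ht ht1 (by push_cast; linarith)
      rwa [Real.rpow_one] at this
    exact h1.trans h2

/-- Hence `ConditionalTripleBound` implies the floored-rigidity fibre bound for every `γ ∈ [0, 1/2]` (the latter is the
weaker hypothesis). -/
theorem productFibreBound_flooredRigidity_of_conditionalTripleBound {γ : ℝ} (hγ0 : 0 ≤ γ) (hγ : γ ≤ 1 / 2)
    (h : ConditionalTripleBound) : ProductFibreBound (flooredRigidityFactor γ) :=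
  productFibreBound_mono (g := triplePairFactor)
    (fun t x ht _ _ => by unfold triplePairFactor; positivity)
    (fun t x ht ht1 _ => triplePairFactor_le_flooredRigidityFactor hγ0 hγ ht ht1)
    (conditionalTripleBound_iff_productFibreBound.mp h)


end Summit.QuantumFields.YangMills.Theorems.EguchiKawaiDirectionLadder

end
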